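import Summits.ResolutionOfSingularities.ResolutionOfSingularities.Theorems.PurelyInseparableDim4AtlasChild
import Summits.ResolutionOfSingularities.ResolutionOfSingularities.Theorems.PurelyInseparableDim4AtlasSiblingsDisjoint
import Summits.ResolutionOfSingularities.ResolutionOfSingularities.Theorems.PurelyInseparableDim4JointChartNormalise
import Summits.ResolutionOfSingularities.ResolutionOfSingularities.Theorems.PurelyInseparableDim4JointForestStep
import HarnessLib

/-!
# Purely inseparable four-folds: the STEP AT ONE READING of an atlas member — children, disjointness, cover of the order-`p` points over the
# owned part, finitely many leaf points (brick S3 (c) v4, tranche 1, brick A3-reading; cell `res-dim4-pi`)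

[OURS · counted 0] (D-0157 DOOR 2; host item stmt-ResolutionOfSingularities-16155, helper). Nothing here proves resolution of
singularities in dimension ≥ 4 / characteristic `p`. 61d's `joint_forest_step_hereditary` for ATLAS readings (no waiting,
`res-dim4-typ-3/S3c-V4-ATLAS-MEMBERS-DESIGN.md` §2 A3): in the setting of the child package A1 at a reading `(s, S, X, D)` of a member blown
up by `π`, and given `BlockA`'s clauses AT this reading — (P1) admissible entries `Pl`, (P2) separated entries, (P5) three-way cover of the
OWNED normalised equimultiple pairs by entries / escaping siblings' closures / leaves `L` — : every entry has its atlas child (A1), the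
children are pairwise disjoint (A3-siblings), every CLOSED point of `W` of order `≥ p` over the OWNED part `φ(ψ⁻¹ ownedSetZ S X)` lies on a
child or is a LEAF point carrying a point chart reading v3's step state, and the leaf points are finitely many (they inject into `L`).

* `zigzag_point_under`, **`atlas_reading_step`**. AI-produced formalisation, weaker than expert review.
bears_on: LADDER-RESOLUTION:D157-DOOR2 (res-dim4-pi · S3 (c) v4 A3-reading).
-/

set_option linter.dupNamespace false -- D-0017: single-problem summit path `Summit.<S>.<S>.…` by design

noncomputable section

open MvPolynomial Finset CategoryTheory AlgebraicGeometry Opposite TopologicalSpace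
open AlgebraicGeometry.Scheme.IdealSheafData (ofIdealTop vanishingIdeal)

namespace Summit.ResolutionOfSingularities.ResolutionOfSingularities.Theorems.PIDim4

open Literature.AlgebraicGeometry.Resolution
open Literature.AlgebraicGeometry.Resolution.Hauser2010
open Literature.AlgebraicGeometry.Resolution.AffinePointBlowup (P A γ coord Wtop ξ)

namespace Equimultiple

section ReadingStep

variable {K : Type} [Field K] {p : ℕ} [hp : Fact p.Prime] [CharP K p] [DecidableEq K]
variable {Z Y W Bl : Scheme.{0}} (φ : Y ⟶ Z) [IsOpenImmersion φ] (ψ : Y ⟶ P 4 K) [IsOpenImmersion ψ]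
  {π : W ⟶ Z} {B : Bl ⟶ P 4 K} {S : Finset (Fin 4)}
  (ε : (π ⁻¹ᵁ φ.opensRange : Scheme.{0}) ≅ (B ⁻¹ᵁ ψ.opensRange : Scheme.{0}))

omit hp [CharP K p] [DecidableEq K] in
/-- **The point of `Y` under a point of `π⁻¹φ(Y)`**: `φ y = π w` and `ψ y = B(ι(ε w))`. [cite: GortzWedhorn2020, Prop. 13.91] -/
theorem zigzag_point_under
    (hsq : ε.hom ≫ (B ∣_ ψ.opensRange) = (π ∣_ φ.opensRange) ≫ (φ.isoOpensRange.inv ≫ ψ.isoOpensRange.hom))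
    (w : W) (hwV : w ∈ π ⁻¹ᵁ φ.opensRange) :
    ∃ y : Y, φ y = π w ∧ ψ y = B ((B ⁻¹ᵁ ψ.opensRange).ι (ε.hom ⟨w, hwV⟩)) := by
  have hφι : ∀ q : Y, φ.opensRange.ι (φ.isoOpensRange.hom q) = φ q := fun q => by
    rw [← Scheme.Hom.comp_apply, Scheme.Hom.isoOpensRange_hom_ι]
  have hψι : ∀ q : Y, ψ.opensRange.ι (ψ.isoOpensRange.hom q) = ψ q := fun q => by
    rw [← Scheme.Hom.comp_apply, Scheme.Hom.isoOpensRange_hom_ι]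
  obtain ⟨y, hy⟩ : ∃ y : Y, y = φ.isoOpensRange.inv ((π ∣_ φ.opensRange) ⟨w, hwV⟩) := ⟨_, rfl⟩
  have hy1 : φ.isoOpensRange.hom y = (π ∣_ φ.opensRange) ⟨w, hwV⟩ := by
    rw [hy, ← Scheme.Hom.comp_apply, Iso.inv_hom_id]; rfl
  have hy2 : ψ.isoOpensRange.hom y = (B ∣_ ψ.opensRange) (ε.hom ⟨w, hwV⟩) := by
    rw [hy, ← Scheme.Hom.comp_apply, ← Scheme.Hom.comp_apply, ← hsq, Scheme.Hom.comp_apply]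
  refine ⟨y, ?_, ?_⟩
  · rw [← hφι, hy1, Scheme.Opens.ι_apply, morphismRestrict_base_coe]
  · rw [← hψι, hy2, Scheme.Opens.ι_apply, morphismRestrict_base_coe, Scheme.Opens.ι_apply]

/-- **THE STEP AT ONE READING OF AN ATLAS MEMBER.** See the module docstring. [cite: BierstoneGrigorievMilmanWlodarczyk2011, Def. 3.1.3;
§4 Step 2b] [cite: Hauser2010, §§F–G] -/
theorem atlas_reading_step [IsLocallyNoetherian Z] [IsAlgClosed K] [DecidableEq (AReading K)] (Zc : Z.IdealSheafData)
    (hπ : IsBlowup π Zc) (hB : IsBlowup B (AffineCoordBlowup.𝓘Λ 4 K (insert 0 (Fin.succ '' (S : Set (Fin 4))))))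
    (hsq : ε.hom ≫ (B ∣_ ψ.opensRange) = (π ∣_ φ.opensRange) ≫ (φ.isoOpensRange.inv ≫ ψ.isoOpensRange.hom))
    (hC' : ((AffineCoordBlowup.𝓘Λ 4 K (insert 0 (Fin.succ '' (S : Set (Fin 4))))).comap ψ.opensRange.ι).comap
        (φ.isoOpensRange.inv ≫ ψ.isoOpensRange.hom) = Zc.comap φ.opensRange.ι)
    (M : MarkedIdeal Z) (hmult : M.mult = p) (s : State K) (hF : s.F ≠ 0)
    (hclean : Literature.Barriers.ResolutionOfSingularities.HauserPerlega.IsClean p s.F)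
    (hKEY : ((controlledTransform B (AffineCoordBlowup.𝓘Λ 4 K (insert 0 (Fin.succ '' (S : Set (Fin 4)))))
        (hypSheaf p s.F) p).comap (B ⁻¹ᵁ ψ.opensRange).ι).comap ε.hom =
      (controlledTransform π Zc M.ideal p).comap (π ⁻¹ᵁ φ.opensRange).ι)
    (hperm : (p : ℕ∞) ≤ CentreBlowup.ordAlong S s.F)
    (hsee : (AffineCoordBlowup.CΛ 4 K (insert 0 (Fin.succ '' (S : Set (Fin 4)))) : Set (P 4 K)) ⊆ Set.range ψ)
    (hsncZ : HasSNCWith M.boundary Zc) (idx : Z.IdealSheafData → Fin 4) (cst : Z.IdealSheafData → K)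
    (hshape : ∀ D ∈ M.boundary, ((D.support : Set Z) ∩ φ '' (ψ ⁻¹'
        (AffineCoordBlowup.CΛ 4 K (insert 0 (Fin.succ '' (S : Set (Fin 4)))) : Set (P 4 K)))).Nonempty →
      D.comap φ = (ofIdealTop (Ideal.span {(γ 4 K).symm (X (idx D).succ + C (cst D))})).comap ψ ∧ (idx D ∈ S → cst D = 0))
    (hinj : ∀ D₁ ∈ M.boundary, ∀ D₂ ∈ M.boundary,
      ((D₁.support : Set Z) ∩ φ '' (ψ ⁻¹' (AffineCoordBlowup.CΛ 4 K (insert 0 (Fin.succ '' (S : Set (Fin 4)))) : Set (P 4 K)))).Nonempty →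
      ((D₂.support : Set Z) ∩ φ '' (ψ ⁻¹' (AffineCoordBlowup.CΛ 4 K (insert 0 (Fin.succ '' (S : Set (Fin 4)))) : Set (P 4 K)))).Nonempty →
      idx D₁ = idx D₂ → D₁ = D₂)
    (Xd : Finset (Fin 4 × K)) (Dd : Finset (Fin 4)) (hXd : ∀ iv ∈ Xd, iv.1 ∈ Dd) (hDdS : ∀ m ∈ Dd, m ∉ S)
    (hfib : ∀ v : Fin 4 → K, IsClosed (φ '' (ψ ⁻¹' ownedSetZ S (Dd.image fun m => (m, v m)))))
    (Pl : Finset (Fin 4 × (Fin 4 → K) × Finset (Fin 4)))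
    (hP1 : ∀ e ∈ Pl, e.1 ∈ S ∧ e.2.1 e.1 = 0 ∧ e.1 ∈ e.2.2 ∧ Dd ⊆ e.2.2 ∧ (∀ iv ∈ Xd, e.2.1 iv.1 = iv.2) ∧
      CentreBlowup.IsEquimultiplePoint p S e.1 e.2.1 s ∧ IsPermissibleCentre p e.2.2 (CentreBlowup.step p S e.1 e.2.1 s).F ∧
      (IsEscaping S e → (∀ i ∈ S, e.2.1 i = 0) ∧
        ∀ l ∈ S \ e.2.2, IsPermissibleCentre p (insert l (e.2.2.erase e.1)) (escState p S l e.2.1 s).F))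
    (hP2 : ∀ e ∈ Pl, ∀ e' ∈ Pl, e ≠ e' →
      (∃ i ∈ e.2.2, i ∈ e'.2.2 ∧ i ∉ S ∧ e.2.1 i ≠ e'.2.1 i) ∨
      (¬ IsEscaping S e ∧ ¬ IsEscaping S e' ∧
        ((e.1 = e'.1 ∧ ∃ i ∈ e.2.2, i ∈ e'.2.2 ∧ e.2.1 i ≠ e'.2.1 i) ∨
         (e.1 ≠ e'.1 ∧ ((e'.2.1 e.1 = 0 ∧ e.1 ∈ e'.2.2) ∨ (e.2.1 e'.1 = 0 ∧ e'.1 ∈ e.2.2))))) ∨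
      (IsEscaping S e ∧ ¬ IsEscaping S e' ∧
        (e'.1 ∉ insert e.1 (S \ e.2.2) ∨ ∃ i ∈ S, e'.2.1 i ≠ 0 ∧ i ∉ insert e.1 (S \ e.2.2))) ∨
      (IsEscaping S e' ∧ ¬ IsEscaping S e ∧
        (e.1 ∉ insert e'.1 (S \ e'.2.2) ∨ ∃ i ∈ S, e.2.1 i ≠ 0 ∧ i ∉ insert e'.1 (S \ e'.2.2))) ∨
      (IsEscaping S e ∧ IsEscaping S e' ∧ Disjoint (insert e.1 (S \ e.2.2)) (insert e'.1 (S \ e'.2.2))))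
    (L : Finset (Fin 4 × (Fin 4 → K)))
    (hP5 : ∀ (j' : Fin 4) (b' : Fin 4 → K), j' ∈ S → b' j' = 0 → (∀ k ∈ S, k < j' → b' k = 0) →
      (∀ iv ∈ Xd, b' iv.1 = iv.2) → CentreBlowup.IsEquimultiplePoint p S j' b' s →
      (∃ e ∈ Pl, e.1 = j' ∧ ∀ i ∈ e.2.2, b' i = e.2.1 i) ∨
      (∃ e ∈ Pl, IsEscaping S e ∧ e.1 ≠ j' ∧ j' ∉ e.2.2 ∧
        (∀ i ∈ e.2.2, i ∈ S → i ≠ e.1 → b' i = 0) ∧ (∀ i ∈ e.2.2, i ∉ S → b' i = e.2.1 i)) ∨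
      (j', b') ∈ L) :
    ∃ (kid : Fin 4 × (Fin 4 → K) × Finset (Fin 4) → Closeds W)
      (Θ : Fin 4 × (Fin 4 → K) × Finset (Fin 4) → Fin 4 → (A 4 K ≃ₐ[K] A 4 K)),
      (∀ e ∈ Pl,
        (∀ m ∈ insert e.1 (S \ e.2.2), ∀ i : Fin 4, Θ e m (X i.succ) = X i.succ + C (e.2.1 i)) ∧
        (∀ m ∈ insert e.1 (S \ e.2.2), ∃ h : MvPolynomial (Fin 4) K, Θ e m (X 0) = X 0 + rename Fin.succ h) ∧
        -- the model readings of the transform on the charts, and the order along the chart centres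
        (∀ (m : Fin 4) (hmS : m ∈ S), (m = e.1 ∨ m ∉ e.2.2) →
          (controlledTransform B (AffineCoordBlowup.𝓘Λ 4 K (insert 0 (Fin.succ '' (S : Set (Fin 4))))) (hypSheaf p s.F) p).comap
              (Spec.map (CommRingCat.ofHom (Θ e m : A 4 K →+* A 4 K)) ≫
                AffineCoordBlowup.chartImm hB (ChartDictionary.succ_mem_centreVars hmS)) =
            hypSheaf p (if m = e.1 then (CentreBlowup.step p S e.1 e.2.1 s).F else (escState p S m e.2.1 s).F) ∧
          (p : ℕ∞) ≤ CentreBlowup.ordAlong (if m = e.1 then e.2.2 else insert m (e.2.2.erase e.1))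
            (if m = e.1 then (CentreBlowup.step p S e.1 e.2.1 s).F else (escState p S m e.2.1 s).F)) ∧
        -- membership through `ε`, chartwise
        (∀ (w : W) (hwV : w ∈ π ⁻¹ᵁ φ.opensRange), w ∈ (kid e : Set W) ↔
          ∃ (m : Fin 4) (hmS : m ∈ S), (m = e.1 ∨ m ∉ e.2.2) ∧
            ((B ⁻¹ᵁ ψ.opensRange).ι (ε.hom ⟨w, hwV⟩) : Bl) ∈
              (Spec.map (CommRingCat.ofHom (Θ e m : A 4 K →+* A 4 K)) ≫
                AffineCoordBlowup.chartImm hB (ChartDictionary.succ_mem_centreVars hmS)) ''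
                (AffineCoordBlowup.CΛ 4 K (insert 0 (Fin.succ ''
                  ((if m = e.1 then e.2.2 else insert m (e.2.2.erase e.1) : Finset (Fin 4)) : Set (Fin 4)))) : Set (P 4 K))) ∧
        -- chart images agree on overlaps
        (∀ (m : Fin 4) (hmS : m ∈ S), (m = e.1 ∨ m ∉ e.2.2) → ∀ (m' : Fin 4) (hm'S : m' ∈ S), (m' = e.1 ∨ m' ∉ e.2.2) →
          (Spec.map (CommRingCat.ofHom (Θ e m : A 4 K →+* A 4 K)) ≫
              AffineCoordBlowup.chartImm hB (ChartDictionary.succ_mem_centreVars hmS)) ''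
              (AffineCoordBlowup.CΛ 4 K (insert 0 (Fin.succ ''
                ((if m = e.1 then e.2.2 else insert m (e.2.2.erase e.1) : Finset (Fin 4)) : Set (Fin 4)))) : Set (P 4 K)) ∩
            Set.range (AffineCoordBlowup.chartImm hB (ChartDictionary.succ_mem_centreVars hm'S)) ⊆
          (Spec.map (CommRingCat.ofHom (Θ e m' : A 4 K →+* A 4 K)) ≫
              AffineCoordBlowup.chartImm hB (ChartDictionary.succ_mem_centreVars hm'S)) ''
              (AffineCoordBlowup.CΛ 4 K (insert 0 (Fin.succ ''
                ((if m' = e.1 then e.2.2 else insert m' (e.2.2.erase e.1) : Finset (Fin 4)) : Set (Fin 4)))) : Set (P 4 K))) ∧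
        (kid e : Set W) ⊆ π ⁻¹' (φ '' (ψ ⁻¹' ownedSetZ S ((e.2.2 \ S).image fun m => (m, e.2.1 m)))) ∧
        (kid e : Set W).Nonempty ∧
        Scheme.IsRegular (vanishingIdeal (kid e)).subscheme ∧
        HasSNCWith (M.transform π Zc).boundary (vanishingIdeal (kid e)) ∧
        MemberAtlasZF p (M.transform π Zc) (kid e)
          (insert (mainReading p (s, S, Xd, Dd) e)
            ((S \ e.2.2).image fun l => extraReading p (s, S, Xd, Dd) e l))) ∧
      (∀ e ∈ Pl, ∀ e' ∈ Pl, e ≠ e' → Disjoint (kid e : Set W) (kid e' : Set W)) ∧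
      (∀ w : W, IsClosed ({w} : Set W) → π w ∈ φ '' (ψ ⁻¹' ownedSetZ S Xd) →
        (p : ℕ∞) ≤ idealOrder (M.transform π Zc).ideal w →
        (∃ e ∈ Pl, w ∈ (kid e : Set W)) ∨
        ∃ l ∈ L, l.1 ∈ S ∧ l.2 l.1 = 0 ∧ CentreBlowup.IsEquimultiplePoint p S l.1 l.2 s ∧
          ∃ (Y' : Scheme.{0}) (φ' : Y' ⟶ W) (ψ' : Y' ⟶ P 4 K) (_ : IsOpenImmersion φ') (_ : IsOpenImmersion ψ') (y' : Y'),
            φ' y' = w ∧ ψ' y' = ξ 4 K ∧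
            (M.transform π Zc).ideal.comap φ' = (hypSheaf p (CentreBlowup.step p S l.1 l.2 s).F).comap ψ') ∧
      {w : W | IsClosed ({w} : Set W) ∧ π w ∈ φ '' (ψ ⁻¹' ownedSetZ S Xd) ∧
        (p : ℕ∞) ≤ idealOrder (M.transform π Zc).ideal w ∧ ∀ e ∈ Pl, w ∉ (kid e : Set W)}.Finite := by
  classical
  -- the children (A1)
  have pkg := fun (e : Fin 4 × (Fin 4 → K) × Finset (Fin 4)) (he : e ∈ Pl) =>
    atlas_child_package φ ψ ε Zc hπ hB hsq hC' M hmult s hF hclean hKEY hperm hsee hsncZ idx cst hshape hinj Xd Dd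
      (hP1 e he).1 (hP1 e he).2.1 (hP1 e he).2.2.1 (fun hE => ((hP1 e he).2.2.2.2.2.2.2 hE).1)
      (fun m hm => ⟨(hP1 e he).2.2.2.1 hm, hDdS m hm⟩) hXd (hfib e.2.1) (hP1 e he).2.2.2.2.2.2.1.2
  let kid : Fin 4 × (Fin 4 → K) × Finset (Fin 4) → Closeds W := fun e => if he : e ∈ Pl then (pkg e he).choose else ⊥
  let Θ : Fin 4 × (Fin 4 → K) × Finset (Fin 4) → Fin 4 → (A 4 K ≃ₐ[K] A 4 K) := fun e =>
    if he : e ∈ Pl then (pkg e he).choose_spec.choose else fun _ => AlgEquiv.refl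
  have hkid : ∀ e (he : e ∈ Pl), kid e = (pkg e he).choose := fun e he => dif_pos he
  have hΘ : ∀ e (he : e ∈ Pl), Θ e = (pkg e he).choose_spec.choose := fun e he => dif_pos he
  have hdata : ∀ e (he : e ∈ Pl), _ := fun e he => (pkg e he).choose_spec.choose_spec
  -- every child lies in `π⁻¹ φ(Y)`
  have hkV : ∀ e (he : e ∈ Pl), ((pkg e he).choose : Set W) ⊆ ((π ⁻¹ᵁ φ.opensRange : W.Opens) : Set W) := by
    intro e he w hw
    obtain ⟨-, -, -, -, -, hover, -⟩ := hdata e he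
    obtain ⟨y, -, hy⟩ := hover hw
    exact ⟨y, hy⟩
  -- the model description of a closed order-`p` point over the reading
  have hsub : φ '' (ψ ⁻¹' ownedSetZ S Xd) ⊆
      φ '' (ψ ⁻¹' (AffineCoordBlowup.CΛ 4 K (insert 0 (Fin.succ '' (S : Set (Fin 4)))) : Set (P 4 K))) :=
    Set.image_mono (Set.preimage_mono fun x hx => by simp only [ownedSetZ, Set.mem_setOf_eq] at hx; exact hx.1)
  have hmodel : ∀ (w : W), IsClosed ({w} : Set W) → π w ∈ φ '' (ψ ⁻¹' ownedSetZ S Xd) →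
      (p : ℕ∞) ≤ idealOrder (M.transform π Zc).ideal w →
      ∃ (hwV : w ∈ π ⁻¹ᵁ φ.opensRange) (j' : Fin 4) (hj' : j' ∈ S) (x : P 4 K) (a' : K) (b' : Fin 4 → K),
        AffineCoordBlowup.chartImm hB (ChartDictionary.succ_mem_centreVars hj') x = (B ⁻¹ᵁ ψ.opensRange).ι (ε.hom ⟨w, hwV⟩) ∧
        x.asIdeal = MvPolynomial.vanishingIdeal K {(Fin.cons a' b' : Fin (4 + 1) → K)} ∧
        a' ^ p + MvPolynomial.eval b' (CentreBlowup.chartTransform p S j' s.F) = 0 ∧ b' j' = 0 ∧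
        (∀ k ∈ S, k < j' → b' k = 0) ∧ CentreBlowup.IsEquimultiplePoint p S j' b' s ∧ (∀ iv ∈ Xd, b' iv.1 = iv.2) := by
    intro w hw hwx hord
    obtain ⟨hwV, j', hj', x, a', b', hxw, hx, hab, hbj', hnorm, heq⟩ :=
      leaf_model_point_normalised φ ψ ε Zc hB hsq M hmult s hKEY hperm hw (hsub hwx) hord
    refine ⟨hwV, j', hj', x, a', b', hxw, hx, hab, hbj', hnorm, heq, fun iv hiv => ?_⟩
    -- the deferral condition, read off `B ∘ chartImm`
    obtain ⟨y, hφy, hψy⟩ := zigzag_point_under φ ψ ε hsq w hwV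
    obtain ⟨y₀, hy₀, hy₀w⟩ := hwx
    have hyy : y₀ = y := φ.isOpenEmbedding.injective (hy₀w.trans hφy.symm)
    subst hyy
    have hmem : (X iv.1.succ - C iv.2 : A 4 K) ∈ (ψ y₀).asIdeal := by
      have h := hy₀
      simp only [Set.mem_preimage, ownedSetZ, Set.mem_setOf_eq] at h
      exact h.2 iv hiv
    have hnot : iv.1.succ ∉ (insert 0 (Fin.succ '' (S : Set (Fin 4))) : Set (Fin (4 + 1))) := fun h =>
      hDdS iv.1 (hXd iv hiv) ((ChartDictionary.succ_mem_centreVars_iff S iv.1).mp h)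
    rw [hψy, ← hxw, ← Scheme.Hom.comp_apply, AffineCoordBlowup.chartImm_comp hB, Spec.map_apply, PrimeSpectrum.comap_asIdeal,
      Ideal.mem_comap, CommRingCat.hom_ofHom, AlgHom.toRingHom_eq_coe, AlgHom.coe_toRingHom, map_sub,
      coordBlowupSubst_X_of_not_mem K _ _ hnot, coordBlowupSubst_C, hx, MvPolynomial.mem_vanishingIdeal_singleton_iff, map_sub,
      aeval_X, aeval_C, Fin.cons_succ, sub_eq_zero] at hmem
    exact hmem
  -- membership criteria for the children
  have hin_main : ∀ e (he : e ∈ Pl) (w : W) (hwV : w ∈ π ⁻¹ᵁ φ.opensRange) (x : P 4 K) (a' : K) (b' : Fin 4 → K)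
      (hj' : e.1 ∈ S),
      AffineCoordBlowup.chartImm hB (ChartDictionary.succ_mem_centreVars hj') x = (B ⁻¹ᵁ ψ.opensRange).ι (ε.hom ⟨w, hwV⟩) →
      x.asIdeal = MvPolynomial.vanishingIdeal K {(Fin.cons a' b' : Fin (4 + 1) → K)} →
      a' ^ p + MvPolynomial.eval b' (CentreBlowup.chartTransform p S e.1 s.F) = 0 →
      (∀ i ∈ e.2.2, b' i = e.2.1 i) → w ∈ ((pkg e he).choose : Set W) := by
    intro e he w hwV x a' b' hj' hxw hx hab hagree
    obtain ⟨hΘs, -, hmod, hmem, -⟩ := hdata e he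
    rw [hmem w hwV, ← hxw]
    obtain ⟨hread, hG⟩ := hmod e.1 hj' (Or.inl rfl)
    rw [if_pos rfl] at hread
    rw [if_pos rfl, if_pos rfl] at hG
    refine ⟨e.1, hj', Or.inl rfl, ?_⟩
    rw [if_pos rfl]
    exact ChartDictionary.mem_image_CΛ_chart_of_agree hj' (hΘs e.1 (Finset.mem_insert_self _ _)) hB hp.out.ne_zero s hperm hG
      hread hx hab hagree
  have hin_extra : ∀ e (he : e ∈ Pl) (w : W) (hwV : w ∈ π ⁻¹ᵁ φ.opensRange) (x : P 4 K) (a' : K) (b' : Fin 4 → K)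
      {j' : Fin 4} (hj' : j' ∈ S), IsEscaping S e → j' ≠ e.1 → j' ∉ e.2.2 →
      AffineCoordBlowup.chartImm hB (ChartDictionary.succ_mem_centreVars hj') x = (B ⁻¹ᵁ ψ.opensRange).ι (ε.hom ⟨w, hwV⟩) →
      x.asIdeal = MvPolynomial.vanishingIdeal K {(Fin.cons a' b' : Fin (4 + 1) → K)} →
      a' ^ p + MvPolynomial.eval b' (CentreBlowup.chartTransform p S j' s.F) = 0 → b' j' = 0 →
      (∀ i ∈ e.2.2, i ∈ S → i ≠ e.1 → b' i = 0) → (∀ i ∈ e.2.2, i ∉ S → b' i = e.2.1 i) →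
      w ∈ ((pkg e he).choose : Set W) := by
    intro e he w hwV x a' b' j' hj' hesc hj'e hj'S hxw hx hab hbj' hag1 hag2
    obtain ⟨hΘs, -, hmod, hmem, -⟩ := hdata e he
    have hbS := ((hP1 e he).2.2.2.2.2.2.2 hesc).1
    rw [hmem w hwV, ← hxw]
    obtain ⟨hread, hG⟩ := hmod j' hj' (Or.inr hj'S)
    rw [if_neg hj'e] at hread
    rw [if_neg hj'e, if_neg hj'e] at hG
    refine ⟨j', hj', Or.inr hj'S, ?_⟩
    rw [if_neg hj'e]
    refine ChartDictionary.mem_image_CΛ_chart_of_agree hj'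
      (hΘs j' (Finset.mem_insert_of_mem (Finset.mem_sdiff.mpr ⟨hj', hj'S⟩))) hB hp.out.ne_zero s hperm hG hread hx hab ?_
    intro i hi
    rcases Finset.mem_insert.mp hi with rfl | hi
    · rw [hbj', hbS i hj']
    · obtain ⟨hie, hiS''⟩ := Finset.mem_erase.mp hi
      by_cases hiS : i ∈ S
      · rw [hag1 i hiS'' hiS hie, hbS i hiS]
      · exact hag2 i hiS'' hiS
  refine ⟨kid, Θ, fun e he => ?_, fun e he e' he' hne => ?_, fun w hw hwx hord => ?_, ?_⟩
  · -- the children's packages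
    rw [hkid e he, hΘ e he]
    exact hdata e he
  · -- pairwise disjointness (A3-siblings)
    rw [hkid e he, hkid e' he']
    obtain ⟨hΘs, -, -, hmem, hcomp, hover, -⟩ := hdata e he
    obtain ⟨hΘs', -, -, hmem', hcomp', hover', -⟩ := hdata e' he'
    have hΘT : ∀ m ∈ S, (m = e.1 ∨ m ∉ e.2.2) → ∀ i : Fin 4, (pkg e he).choose_spec.choose m (X i.succ) = X i.succ + C (e.2.1 i) :=
      fun m hmS hm => hΘs m (hm.elim (fun h => h ▸ Finset.mem_insert_self _ _)
        (fun h => Finset.mem_insert_of_mem (Finset.mem_sdiff.mpr ⟨hmS, h⟩)))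
    have hΘT' : ∀ m ∈ S, (m = e'.1 ∨ m ∉ e'.2.2) → ∀ i : Fin 4, (pkg e' he').choose_spec.choose m (X i.succ) = X i.succ + C (e'.2.1 i) :=
      fun m hmS hm => hΘs' m (hm.elim (fun h => h ▸ Finset.mem_insert_self _ _)
        (fun h => Finset.mem_insert_of_mem (Finset.mem_sdiff.mpr ⟨hmS, h⟩)))
    have hsep := hP2 e he e' he' hne
    simp only [IsEscaping, not_not] at hsep
    exact atlas_siblings_disjoint φ ψ ε hB (hP1 e he).1 (hP1 e he).2.2.1 (fun hE => ((hP1 e he).2.2.2.2.2.2.2 hE).1) _ hΘT _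
      (hkV e he) hmem hcomp hover (hP1 e' he').1 (hP1 e' he').2.2.1 (fun hE => ((hP1 e' he').2.2.2.2.2.2.2 hE).1) _ hΘT' _
      hmem' hcomp' hover' hsep
  · -- THREE-WAY COVER over the owned part
    obtain ⟨hwV, j', hj', x, a', b', hxw, hx, hab, hbj', hnorm, heq, hdef⟩ := hmodel w hw hwx hord
    rcases hP5 j' b' hj' hbj' hnorm hdef heq with ⟨e, he, hej, hagree⟩ | ⟨e, he, hesc, hej, hj'S, hag1, hag2⟩ | hl
    · subst hej
      exact Or.inl ⟨e, he, by rw [hkid e he]; exact hin_main e he w hwV x a' b' hj' hxw hx hab hagree⟩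
    · exact Or.inl ⟨e, he, by rw [hkid e he]; exact hin_extra e he w hwV x a' b' hj' hesc (Ne.symm hej) hj'S hxw hx hab hbj' hag1 hag2⟩
    · obtain ⟨Θl, -, -, -, hchart⟩ := leaf_chart φ ψ ε Zc hB M hmult s hKEY hperm hwV hj' hxw hx hab hbj'
      exact Or.inr ⟨(j', b'), hl, hj', hbj', heq, hchart⟩
  · -- the leaf points are finitely many: they inject into `L`
    have cover : ∀ w : W, IsClosed ({w} : Set W) → π w ∈ φ '' (ψ ⁻¹' ownedSetZ S Xd) →
        (p : ℕ∞) ≤ idealOrder (M.transform π Zc).ideal w → (∀ e ∈ Pl, w ∉ (kid e : Set W)) →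
        ∃ l : Fin 4 × (Fin 4 → K), l ∈ L ∧ ∃ (hwV : w ∈ π ⁻¹ᵁ φ.opensRange) (hj : l.1 ∈ S) (x : P 4 K) (a : K),
          AffineCoordBlowup.chartImm hB (ChartDictionary.succ_mem_centreVars hj) x =
              (B ⁻¹ᵁ ψ.opensRange).ι (ε.hom ⟨w, hwV⟩) ∧
            x.asIdeal = MvPolynomial.vanishingIdeal K {(Fin.cons a l.2 : Fin (4 + 1) → K)} ∧
              a ^ p + MvPolynomial.eval l.2 (CentreBlowup.chartTransform p S l.1 s.F) = 0 := by
      intro w hw hwx hord hout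
      obtain ⟨hwV, j', hj', x, a', b', hxw, hx, hab, hbj', hnorm, heq, hdef⟩ := hmodel w hw hwx hord
      rcases hP5 j' b' hj' hbj' hnorm hdef heq with ⟨e, he, hej, hagree⟩ | ⟨e, he, hesc, hej, hj'S, hag1, hag2⟩ | hl
      · subst hej
        exact absurd (by rw [hkid e he]; exact hin_main e he w hwV x a' b' hj' hxw hx hab hagree) (hout e he)
      · exact absurd (by rw [hkid e he]; exact hin_extra e he w hwV x a' b' hj' hesc (Ne.symm hej) hj'S hxw hx hab hbj' hag1 hag2)
          (hout e he)
      · exact ⟨(j', b'), hl, hwV, hj', x, a', hxw, hx, hab⟩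
    let g : W → Fin 4 × (Fin 4 → K) := fun w =>
      if hc : IsClosed ({w} : Set W) ∧ π w ∈ φ '' (ψ ⁻¹' ownedSetZ S Xd) ∧
          (p : ℕ∞) ≤ idealOrder (M.transform π Zc).ideal w ∧ ∀ e ∈ Pl, w ∉ (kid e : Set W)
      then (cover w hc.1 hc.2.1 hc.2.2.1 hc.2.2.2).choose else ((0 : Fin 4), (0 : Fin 4 → K))
    refine Set.Finite.of_finite_image (f := g) ((Finset.finite_toSet L).subset ?_) ?_
    · rintro _ ⟨w, hw, rfl⟩
      have hg : g w = (cover w hw.1 hw.2.1 hw.2.2.1 hw.2.2.2).choose := dif_pos hw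
      rw [hg]
      exact (cover w hw.1 hw.2.1 hw.2.2.1 hw.2.2.2).choose_spec.1
    · intro w hw w' hw' hgg
      have hg : g w = (cover w hw.1 hw.2.1 hw.2.2.1 hw.2.2.2).choose := dif_pos hw
      have hg' : g w' = (cover w' hw'.1 hw'.2.1 hw'.2.2.1 hw'.2.2.2).choose := dif_pos hw'
      have key : ∀ l l' : Fin 4 × (Fin 4 → K), l = l' →
          (∃ (hwV : w ∈ π ⁻¹ᵁ φ.opensRange) (hj : l.1 ∈ S) (x : P 4 K) (a : K),
            AffineCoordBlowup.chartImm hB (ChartDictionary.succ_mem_centreVars hj) x =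
                (B ⁻¹ᵁ ψ.opensRange).ι (ε.hom ⟨w, hwV⟩) ∧
              x.asIdeal = MvPolynomial.vanishingIdeal K {(Fin.cons a l.2 : Fin (4 + 1) → K)} ∧
                a ^ p + MvPolynomial.eval l.2 (CentreBlowup.chartTransform p S l.1 s.F) = 0) →
          (∃ (hwV : w' ∈ π ⁻¹ᵁ φ.opensRange) (hj : l'.1 ∈ S) (x : P 4 K) (a : K),
            AffineCoordBlowup.chartImm hB (ChartDictionary.succ_mem_centreVars hj) x =
                (B ⁻¹ᵁ ψ.opensRange).ι (ε.hom ⟨w', hwV⟩) ∧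
              x.asIdeal = MvPolynomial.vanishingIdeal K {(Fin.cons a l'.2 : Fin (4 + 1) → K)} ∧
                a ^ p + MvPolynomial.eval l'.2 (CentreBlowup.chartTransform p S l'.1 s.F) = 0) →
          w = w' := by
        rintro l _ rfl ⟨hwV, hj, x, a, hxw, hx, hab⟩ ⟨hwV', hj', x', a', hxw', hx', hab'⟩
        have haa : a = a' := frobenius_inj K p (by
          rw [frobenius_def, frobenius_def, eq_neg_of_add_eq_zero_left hab, eq_neg_of_add_eq_zero_left hab'])
        have hxx : x = x' := PrimeSpectrum.ext (by rw [hx, hx', haa])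
        subst hxx
        have h1 : (B ⁻¹ᵁ ψ.opensRange).ι (ε.hom ⟨w, hwV⟩) = (B ⁻¹ᵁ ψ.opensRange).ι (ε.hom ⟨w', hwV'⟩) :=
          hxw.symm.trans hxw'
        have h2 := ε.hom.isOpenEmbedding.injective ((B ⁻¹ᵁ ψ.opensRange).ι.isOpenEmbedding.injective h1)
        exact Subtype.ext_iff.mp h2
      exact key _ _ (hg.symm.trans (hgg.trans hg')) (cover w hw.1 hw.2.1 hw.2.2.1 hw.2.2.2).choose_spec.2
        (cover w' hw'.1 hw'.2.1 hw'.2.2.1 hw'.2.2.2).choose_spec.2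

end ReadingStep

end Equimultiple

end Summit.ResolutionOfSingularities.ResolutionOfSingularities.Theorems.PIDim4

end
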